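import Summits.ResolutionOfSingularities.ResolutionOfSingularities.Theorems.WallFrames1
import Summits.ResolutionOfSingularities.ResolutionOfSingularities.Theorems.NearCutCompanion3
import Summits.ResolutionOfSingularities.ResolutionOfSingularities.Theorems.NearCutWalls2
import Summits.ResolutionOfSingularities.ResolutionOfSingularities.Theorems.ProximityCutArcLaw
import Summits.ResolutionOfSingularities.ResolutionOfSingularities.Theorems.MaxContactCutBoundaryLedger
import Summits.ResolutionOfSingularities.ResolutionOfSingularities.Theorems.MaxContactCutWallCut
import Summits.ResolutionOfSingularities.ResolutionOfSingularities.Theorems.PlanarGhostDescent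
import Literature.AlgebraicGeometry.Resolution.PointBlowupIFPGiraud
import Literature.AlgebraicGeometry.Resolution.AdicNoetherian
import HarnessLib

/-!
# WallFrames (2/17) — Kollár's wall descent in a polynomial frame; sections: Transport

Verbatim slice of the farm-checked monolith `WallFrames.lean` of cell `decomp-res`, seat `decomp-res-lens-5`, g35
(sha256 7405a21d81d102a4…, monolith lines 335–598); one namespace `Summit.ResolutionOfSingularities.ResolutionOfSingularities.Theorems.WallFrames` across the
slices, imports chained.  The monolith's module docstring (laws W1–W7, mechanism, novelty, honest placement) is
reproduced in slice 1; the main theorem `balancedWallPort_holds : WallCut.BalancedWallPort` (hypothesis-free) and the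
host-route corollary `ecBalancedWallPort_holds` (aside item 27368 of route MaxContactCut) are in slice 16/17.
-/

open MvPolynomial Finset
open scoped BigOperators
open Literature.AlgebraicGeometry.Resolution
open Literature.AlgebraicGeometry.Resolution.Hauser2010
open Literature.AlgebraicGeometry.Resolution.PointBlowup
open Literature.AlgebraicGeometry.Resolution.HauserPerlega2024

namespace Summit.ResolutionOfSingularities.ResolutionOfSingularities.Theorems.WallFrames

variable {σ : Type*} [Fintype σ] [DecidableEq σ] {K : Type*} [Field K]

omit [Fintype σ] [DecidableEq σ] in
/-- A substitution by `𝔪`-elements does not change the constant coefficient. [folklore] -/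
theorem constantCoeff_aeval_of_forall {f : σ → MvPolynomial σ K} (hf : ∀ i, constantCoeff (f i) = 0)
    (P : MvPolynomial σ K) : constantCoeff (aeval f P) = constantCoeff P := by
  have h : (constantCoeff : MvPolynomial σ K →+* K).comp (aeval f).toRingHom = constantCoeff := by
    refine MvPolynomial.ringHom_ext (fun c => ?_) (fun i => ?_)
    · simp
    · simp [hf i]
  exact congrArg (fun φ : MvPolynomial σ K →+* K => φ P) h

omit [Fintype σ] [DecidableEq σ] in
/-- `z`-freeness from membership in the supported subalgebra. [folklore] -/
theorem varFree_of_mem_supported {z : σ} {P : MvPolynomial σ K}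
    (h : P ∈ MvPolynomial.supported K ({i | i ≠ z} : Set σ)) : (∀ μ ∈ P.support, μ z = 0) := by
  rw [MvPolynomial.mem_supported] at h
  intro d hd
  by_contra hdz
  have : z ∈ (↑P.vars : Set σ) := by
    rw [Finset.mem_coe, MvPolynomial.mem_vars_iff_mem_support]
    exact ⟨d, hd, Finsupp.mem_support_iff.mpr hdz⟩
  exact (h this) rfl

omit [Fintype σ] [DecidableEq σ] in
/-- Substitution by data supported away from `z` lands in polynomials free of `z`. [folklore] -/
theorem varFree_aeval {z : σ} {f : σ → MvPolynomial σ K} (hf : ∀ i, (∀ μ ∈ (f i).support, μ z = 0)) (P : MvPolynomial σ K) :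
    (∀ μ ∈ (aeval f P).support, μ z = 0) := by
  apply varFree_of_mem_supported
  induction P using MvPolynomial.induction_on with
  | C c => rw [aeval_C]; exact Subalgebra.algebraMap_mem _ c
  | add p q hp hq => rw [map_add]; exact Subalgebra.add_mem _ hp hq
  | mul_X p i hp => rw [map_mul, aeval_X]; exact Subalgebra.mul_mem _ hp (mem_supported_of_varFree (hf i))

omit [Fintype σ] in
/-- `varFree_add`: WallFrames (lens-5 g35) computation rule; docstring added by the writer (lint.docstring) [folklore] -/
theorem varFree_add {z : σ} {P Q : MvPolynomial σ K} (hP : (∀ μ ∈ P.support, μ z = 0)) (hQ : (∀ μ ∈ Q.support, μ z = 0)) : (∀ μ ∈ (P + Q).support, μ z = 0) := by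
  intro d hd
  rcases Finset.mem_union.mp (MvPolynomial.support_add hd) with h | h
  · exact hP d h
  · exact hQ d h

omit [Fintype σ] in
/-- `varFree_sub`: WallFrames (lens-5 g35) computation rule; docstring added by the writer (lint.docstring) [folklore] -/
theorem varFree_sub {z : σ} {P Q : MvPolynomial σ K} (hP : (∀ μ ∈ P.support, μ z = 0)) (hQ : (∀ μ ∈ Q.support, μ z = 0)) : (∀ μ ∈ (P - Q).support, μ z = 0) := by
  rw [sub_eq_add_neg]; exact varFree_add hP (varFree_neg hQ)

omit [Fintype σ] [DecidableEq σ] in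
/-- `varFree_monomial`: WallFrames (lens-5 g35) computation rule; docstring added by the writer (lint.docstring) [folklore] -/
theorem varFree_monomial {z : σ} {d : σ →₀ ℕ} (hd : d z = 0) (c : K) : (∀ μ ∈ (monomial d c).support, μ z = 0) := by
  intro d' hd'
  classical
  have := support_monomial_subset hd'
  rw [Finset.mem_singleton] at this
  rw [this]; exact hd

omit [Fintype σ] [DecidableEq σ] in
/-- `varFree_C`: WallFrames (lens-5 g35) computation rule; docstring added by the writer (lint.docstring) [folklore] -/
theorem varFree_C (z : σ) (c : K) : (∀ μ ∈ (C c : MvPolynomial σ K).support, μ z = 0) := by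
  rw [← monomial_zero']; exact varFree_monomial (by simp) c

omit [Fintype σ] in
/-- `varFree_X_of_ne`: WallFrames (lens-5 g35) computation rule; docstring added by the writer (lint.docstring) [folklore] -/
theorem varFree_X_of_ne {z i : σ} (h : i ≠ z) : (∀ μ ∈ (X i : MvPolynomial σ K).support, μ z = 0) := by
  show ∀ μ ∈ (MvPolynomial.monomial (Finsupp.single i 1) (1 : K)).support, μ z = 0
  exact varFree_monomial (by rw [Finsupp.single_apply, if_neg h]) 1

omit [Fintype σ] [DecidableEq σ] in
/-- `varFree_mul`: WallFrames (lens-5 g35) computation rule; docstring added by the writer (lint.docstring) [folklore] -/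
theorem varFree_mul {z : σ} {P Q : MvPolynomial σ K} (hP : (∀ μ ∈ P.support, μ z = 0)) (hQ : (∀ μ ∈ Q.support, μ z = 0)) : (∀ μ ∈ (P * Q).support, μ z = 0) := by
  intro d hd
  classical
  obtain ⟨a, ha, b, hb, rfl⟩ := Finset.mem_add.mp (MvPolynomial.support_mul P Q hd)
  simp [Finsupp.add_apply, hP a ha, hQ b hb]

omit [Fintype σ] [DecidableEq σ] in
/-- `varFree_homogeneousComponent`: WallFrames (lens-5 g35) computation rule; docstring added by the writer (lint.docstring) [folklore] -/
theorem varFree_homogeneousComponent {z : σ} {P : MvPolynomial σ K} (hP : (∀ μ ∈ P.support, μ z = 0)) (n : ℕ) :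
    (∀ μ ∈ (homogeneousComponent n P).support, μ z = 0) := by
  intro d hd
  classical
  have : d ∈ P.support := by
    rw [mem_support_iff, coeff_homogeneousComponent] at hd
    rw [mem_support_iff]
    intro h; exact hd (by simp [h])
  exact hP d this

omit [Fintype σ] in
/-- The chart transform in a chart `j ≠ z` preserves `z`-freeness. [folklore] -/
theorem varFree_chartTransform {z j : σ} (hjz : j ≠ z) (a : ℕ) {ζ : MvPolynomial σ K} (h : (∀ μ ∈ ζ.support, μ z = 0)) :
    (∀ μ ∈ (chartTransform a j ζ).support, μ z = 0) := by
  intro d' hd'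
  classical
  unfold PointBlowup.chartTransform at hd'
  obtain ⟨d, hd, hdd'⟩ := Finset.mem_biUnion.mp (MvPolynomial.support_sum hd')
  have := support_monomial_subset hdd'
  rw [Finset.mem_singleton] at this
  rw [this, chartExponent_apply, if_neg hjz.symm]
  exact h d hd

/-! ## §2 The exact transport law in a lost-wall chart (Kollár's K1/K2 as a re-indexing)

Roles: `z` = the free (sheared) variable, `j ≠ z` = the chart = the LOST wall, the centre `b = b_z e_z` is torus-fixed
(it lies on the kept wall and on the exceptional divisor).  The frame at the old point is `(walls, y_z − ζ)` with `ζ`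
`z`-free in `𝔪`; the frame at the new point is `(walls', y_z − ζ')`, `ζ' = chartTransform 1 j ζ − b_z`.  THE LAW: the
companion step commutes with the shears EXACTLY, so that in frame coordinates the step `G ↦ translate b (cT_s G)` is the
bare monomial re-indexing `chartTransform s j` — coefficients are carried verbatim (K1a/K1b: `coeff_chartTransform_chartExponent`
in the tree; K2: `chartExponent s j` is injective on degrees `≥ s`). -/

section Transport

variable {z j : σ}

omit [Fintype σ] in
/-- Generator-level form of the transport law: `σ_{ζ'} ∘ τ_b ∘ θ_j = θ_j ∘ σ_ζ` on `K[y]`, `θ_j` the total transform.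
[new] -/
theorem zshear_comp_translate_comp_total (hjz : j ≠ z) {ζ : MvPolynomial σ K} (hζ1 : (1 : ℕ∞) ≤ ordZero ζ)
    {b : σ → K} (hb : ∀ i, i ≠ z → b i = 0) :
    (zshear z (chartTransform 1 j ζ - C (b z))).comp
        ((aeval fun i => X i + C (b i)).comp (aeval fun i => if i = j then X j else X j * X i)) =
      (aeval fun i => if i = j then X j else X j * X i).comp (zshear z ζ) := by
  refine MvPolynomial.algHom_ext fun i => ?_
  have hθζ : (aeval fun i => if i = j then X j else X j * X i) ζ = X j ^ 1 * chartTransform 1 j ζ :=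
    (X_pow_mul_chartTransform j hζ1).symm
  simp only [AlgHom.comp_apply, aeval_X]
  by_cases hij : i = j
  · subst hij
    rw [if_pos rfl, aeval_X, hb i hjz, C_0, add_zero, zshear_X_of_ne hjz, zshear_X_of_ne hjz, aeval_X, if_pos rfl]
  · rw [if_neg hij, map_mul, aeval_X, aeval_X, hb j hjz, C_0, add_zero, map_mul, zshear_X_of_ne hjz]
    by_cases hiz : i = z
    · subst hiz
      rw [map_add, zshear_X_self, zshear_C, zshear_X_self, map_add, aeval_X, if_neg hij, hθζ]
      ring
    · rw [hb i hiz, C_0, add_zero, zshear_X_of_ne hiz, zshear_X_of_ne hiz, aeval_X, if_neg hij]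

omit [Fintype σ] in
/-- **THE EXACT TRANSPORT LAW (lost-wall chart).**  For `j ≠ z`, `ζ ∈ 𝔪`, a torus-fixed centre `b = b_z e_z` and
`s ≤ ord₀ G`:  `σ_{ζ'} (translate b (chartTransform s j G)) = chartTransform s j (σ_ζ G)` with
`ζ' = chartTransform 1 j ζ − b_z`.  In the sheared frames the companion step is the bare chart re-indexing. [new] -/
theorem transport_law (hjz : j ≠ z) {ζ : MvPolynomial σ K} (hζ1 : (1 : ℕ∞) ≤ ordZero ζ)
    {b : σ → K} (hb : ∀ i, i ≠ z → b i = 0) {s : ℕ} {G : MvPolynomial σ K} (hG : (s : ℕ∞) ≤ ordZero G) :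
    zshear z (chartTransform 1 j ζ - C (b z)) (translate b (chartTransform s j G)) =
      chartTransform s j (zshear z ζ G) := by
  have hXj : (X j : MvPolynomial σ K) ^ s ≠ 0 := pow_ne_zero _ (X_ne_zero j)
  have hG' : (s : ℕ∞) ≤ ordZero (zshear z ζ G) := hG.trans (le_ordZero_zshear hζ1 G)
  have hcomp := AlgHom.congr_fun (zshear_comp_translate_comp_total hjz hζ1 hb) G
  simp only [AlgHom.comp_apply] at hcomp
  rw [← X_pow_mul_chartTransform j hG, map_mul, map_mul, map_pow, map_pow, aeval_X, hb j hjz, C_0, add_zero,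
    zshear_X_of_ne hjz, ← X_pow_mul_chartTransform j hG'] at hcomp
  exact mul_left_cancel₀ hXj hcomp

omit [Fintype σ] in
/-- The transported shear datum is again `z`-free. [new] -/
theorem varFree_transport (hjz : j ≠ z) {ζ : MvPolynomial σ K} (hζ : (∀ μ ∈ ζ.support, μ z = 0)) (c : K) :
    (∀ μ ∈ (chartTransform 1 j ζ - C c).support, μ z = 0) :=
  varFree_sub (varFree_chartTransform hjz 1 hζ) (varFree_C z c)

/-- The constant term of the level-one transform is the `y_j`-coefficient: `(cT_1 ζ)(0) = coeff_{e_j} ζ` (`ζ ∈ 𝔪`).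
Hence `ζ' = cT_1 ζ − b_z ∈ 𝔪` iff `b_z = ∂_j ζ(0)` — the RECENTRING CONDITION, discharged by §5. [new] -/
theorem constantCoeff_chartTransform_one (j : σ) {ζ : MvPolynomial σ K} (hζ1 : (1 : ℕ∞) ≤ ordZero ζ) :
    constantCoeff (chartTransform 1 j ζ) = coeff (Finsupp.single j 1) ζ := by
  classical
  unfold PointBlowup.chartTransform
  show coeff 0 (∑ d ∈ ζ.support, monomial (chartExponent 1 j d) (coeff d ζ)) = _
  rw [coeff_sum]
  have hζ0 : ∀ d ∈ ζ.support, 1 ≤ d.degree := by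
    intro d hd
    by_contra h
    push Not at h
    have hd0 : d = 0 := by
      have : d.degree = 0 := by omega
      exact (Finsupp.degree_eq_zero_iff d).mp this
    subst hd0
    have := (one_le_ordZero_iff ζ).mp hζ1
    rw [mem_support_iff] at hd
    exact hd this
  by_cases hmem : Finsupp.single j 1 ∈ ζ.support
  · rw [← Finset.add_sum_erase _ _ hmem, coeff_monomial, if_pos ?_, Finset.sum_eq_zero, add_zero]
    · intro d hd
      rw [coeff_monomial, if_neg]
      intro h0
      have hd' := Finset.mem_of_mem_erase hd
      have hne := Finset.ne_of_mem_erase hd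
      apply hne
      ext i
      have hi := congrArg (fun e : σ →₀ ℕ => e i) h0
      simp only [chartExponent_apply, Finsupp.coe_zero, Pi.zero_apply] at hi
      by_cases hij : i = j
      · subst hij
        rw [if_pos rfl] at hi
        rw [Finsupp.single_eq_same]
        have h1 := hζ0 d hd'
        -- degree d = 1 and all other coordinates vanish
        have hothers : ∀ k, k ≠ i → d k = 0 := by
          intro k hk
          have hk' := congrArg (fun e : σ →₀ ℕ => e k) h0
          simp only [chartExponent_apply, Finsupp.coe_zero, Pi.zero_apply, if_neg hk] at hk'
          exact hk'
        have hdeg : d.degree = d i := by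
          rw [Finsupp.degree_eq_sum, Finset.sum_eq_single i (fun k _ hk => hothers k hk)
            (fun h => absurd (Finset.mem_univ i) h)]
        omega
      · rw [if_neg hij] at hi
        rw [hi, Finsupp.single_eq_of_ne hij]
    · ext i
      simp only [chartExponent_apply, Finsupp.coe_zero, Pi.zero_apply]
      split_ifs with h
      · subst h; simp [Finsupp.degree_single]
      · rw [Finsupp.single_eq_of_ne h]
  · rw [Finset.sum_eq_zero, (notMem_support_iff).mp hmem]
    intro d hd
    rw [coeff_monomial, if_neg]
    intro h0
    apply hmem
    convert hd using 1
    ext i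
    have hi := congrArg (fun e : σ →₀ ℕ => e i) h0
    simp only [chartExponent_apply, Finsupp.coe_zero, Pi.zero_apply] at hi
    by_cases hij : i = j
    · subst hij
      rw [if_pos rfl] at hi
      rw [Finsupp.single_eq_same]
      have h1 := hζ0 d hd
      have hothers : ∀ k, k ≠ i → d k = 0 := by
        intro k hk
        have hk' := congrArg (fun e : σ →₀ ℕ => e k) h0
        simp only [chartExponent_apply, Finsupp.coe_zero, Pi.zero_apply, if_neg hk] at hk'
        exact hk'
      have hdeg : d.degree = d i := by
        rw [Finsupp.degree_eq_sum, Finset.sum_eq_single i (fun k _ hk => hothers k hk)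
          (fun h => absurd (Finset.mem_univ i) h)]
      omega
    · rw [if_neg hij] at hi
      rw [Finsupp.single_eq_of_ne hij, hi]

-- writer g14: `add_le_degree` deleted — dedup.landed twin `NearCut.add_le_degree` (Theorems/NearCutCompanion2, importable via NearCutCompanion3); use site below cites the landed name.

/-- **FAR PARTS STAY FAR (up to `s`).**  If every exponent of `R` has wall-degree (degree off the free variable `z`)
`≥ Λ`, then every exponent of `cT_s^j R` (`j ≠ z` a wall) has wall-degree `≥ Λ − s`. [new] -/
theorem far_chartTransform {z j : σ} (hjz : j ≠ z) {s Λ : ℕ} (hΛ : s ≤ Λ) {R : MvPolynomial σ K}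
    (hR : ∀ d ∈ R.support, Λ + d z ≤ d.degree) :
    ∀ d ∈ (chartTransform s j R).support, (Λ - s) + d z ≤ d.degree := by
  classical
  have hRs : ∀ d ∈ R.support, s ≤ d.degree := fun d hd => by have := hR d hd; omega
  intro d hd
  rw [support_chartTransform s j hRs, Finset.mem_image] at hd
  obtain ⟨d₀, hd₀, rfl⟩ := hd
  have h0 := hR d₀ hd₀
  have h1 := NearCut.add_le_degree hjz d₀
  have hz : chartExponent s j d₀ z = d₀ z := by
    unfold chartExponent; rw [Finsupp.coe_update, Function.update_of_ne (Ne.symm hjz)]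
  have hdeg : (chartExponent s j d₀).degree + d₀ j = d₀.degree + (d₀.degree - s) := by
    unfold chartExponent
    rw [Finsupp.update_eq_erase_add_single, map_add, Finsupp.degree_single]
    have := congrArg Finsupp.degree (Finsupp.erase_add_single j d₀)
    rw [map_add, Finsupp.degree_single] at this
    omega
  rw [hz]; omega

end Transport

end Summit.ResolutionOfSingularities.ResolutionOfSingularities.Theorems.WallFrames
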